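import Literature.Computability.AlgebraicComplexity.MW21SingMaximalSubspaces
import HarnessLib

/-!
# Makam–Wigderson 2021, towards Thm 1.13/1.14 by an elementary route: the kind of a symmetry
# (type-preserving or type-swapping) and the images of column types, row types, rank-one planes

Cell `val-lit`, seat t19 g6; bricks C and D1 of the elementary route to
`makamWigderson2021_thm_1_13` / `_1_14` (sizing memo `HOME/np/NOTE-t19g6-MW21-Thm113-sizing.md`;
brick B = `MW21SingMaximalSubspaces.lean`). Source context: V. Makam, A. Wigderson, J. reine
angew. Math. 780 (2021) = arXiv:1909.00857, Thm 1.13 (p0006:L35), Thm 1.14 (p0006:L40). NOT the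
printed proof (§9 computes a Lie algebra); disclosed. Honest framing: nothing here bears on VP vs
VNP, which is NOT proved.

## Contents (all PROVED; bookkeeping definitions `colIn`, `rowIn`, `perp`, `colType`, `rowType`,
## `colInEquiv`, `rowInEquiv`, and the two predicates `TypePreserving`, `TypeSwapping`)

Write `M_v = ℂ^m ⊗ K_v = tupleOf (kerMat v)`, `M^w = ℂ^m ⊗ K^w = tupleOf (cokerMat w)`.
* Sums: `M_v + M_{v'} = ⊤` for `v ∉ ℂv'` (`sup_tupleOf_kerMat_eq_top`, an explicit splitting
  `X = (X - X₂) + X₂`, `X₂ᵢ = (Xᵢ v) ℓᵀ` with `ℓ·v = 1`, `ℓ·v' = 0`), dually for cokernels, while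
  `M_v + M^w ≠ ⊤` always (`wᵀ Xᵢ v = 0` on the sum); `K_v ≠ K^w` for `n ≥ 2`; `τ` exchanges the two
  families (`map_transposeMap_tupleOf_kerMat`).
* **Step C** `typePreserving_or_typeSwapping`: a linear automorphism `e` of `Mat_n^m` mapping a set
  `S` into itself, where `S ⊇` every `M_v, M^w` and these are exactly the linear subspaces of `S` of
  dimension `m·n(n-1)` (brick B for `S = SING, NSING`), maps each `M_v` to some `M_{v'}` and each
  `M^w` to some `M^{w'}` (`TypePreserving e`), or each `M_v` to some `M^{w'}` and each `M^w` to
  some `M_{v'}` (`TypeSwapping e`) — images lie in the two families by the dimension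
  characterisation, and the sum tests separate the types.
* **Step D1** (for a type-preserving `e`): column types `C_a = tupleOf (colIn ℂa)
  = ⋂_{q ⊥ a} M^q` go to column types (`exists_map_colType_eq`: the image is
  `tupleOf (colIn Y)` with `m·n·dim Y = m·n`), row types `D_b` to row types, hence rank-one planes
  `C_a ∩ D_b = ℂ^m ⊗ (a bᵀ)` to rank-one planes (`map_rankOnePlane`). Ingredients: the
  dot-product separation `exists_perp_not_perp` (`q = a_k e_j - a_j e_k`), the double orthogonal
  `(a^⊥)^⊥ = ℂa`, `colIn ℂa ∩ rowIn ℂb = ℂ·abᵀ`.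

## References

* [MakamWigderson2021] Thms 1.13, 1.14.
* [Dieudonne1948], [Flanders1962] (through brick B).
-/

noncomputable section

open Module Matrix

namespace Literature.Computability.AlgebraicComplexity

namespace MakamWigderson

variable {n m : ℕ}

/-! ### Column and row constraints -/

/-- Matrices all of whose columns lie in `Y`. [folklore] -/
def colIn (Y : Submodule ℂ (Fin n → ℂ)) : Submodule ℂ (Matrix (Fin n) (Fin n) ℂ) where
  carrier := {A | ∀ j, (fun i => A i j) ∈ Y}
  add_mem' := fun hA hB j => by simpa [Pi.add_def] using Y.add_mem (hA j) (hB j)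
  zero_mem' := fun _ => by exact Y.zero_mem
  smul_mem' := fun c _ hA j => by simpa [Pi.smul_def] using Y.smul_mem c (hA j)

/-- Matrices all of whose rows lie in `Y`. [folklore] -/
def rowIn (Y : Submodule ℂ (Fin n → ℂ)) : Submodule ℂ (Matrix (Fin n) (Fin n) ℂ) where
  carrier := {A | ∀ i, A i ∈ Y}
  add_mem' := fun hA hB i => Y.add_mem (hA i) (hB i)
  zero_mem' := fun _ => Y.zero_mem
  smul_mem' := fun c _ hA i => Y.smul_mem c (hA i)

/-- Membership in `colIn`. [cite: MakamWigderson2021, Thm 1.13 (proof, elementary route: linear algebra step)] -/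
theorem mem_colIn {Y : Submodule ℂ (Fin n → ℂ)} {A : Matrix (Fin n) (Fin n) ℂ} :
    A ∈ colIn Y ↔ ∀ j, (fun i => A i j) ∈ Y := Iff.rfl

/-- Membership in `rowIn`. [cite: MakamWigderson2021, Thm 1.13 (proof, elementary route: linear algebra step)] -/
theorem mem_rowIn {Y : Submodule ℂ (Fin n → ℂ)} {A : Matrix (Fin n) (Fin n) ℂ} :
    A ∈ rowIn Y ↔ ∀ i, A i ∈ Y := Iff.rfl

/-- `colIn Y ≅ Yⁿ`. [folklore] -/
def colInEquiv (Y : Submodule ℂ (Fin n → ℂ)) : colIn Y ≃ₗ[ℂ] (Fin n → Y) where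
  toFun A j := ⟨fun i => (A : Matrix (Fin n) (Fin n) ℂ) i j, A.2 j⟩
  map_add' A B := by ext; rfl
  map_smul' c A := by ext; rfl
  invFun f := ⟨Matrix.of fun i j => (f j : Fin n → ℂ) i, fun j => (f j).2⟩
  left_inv A := by rfl
  right_inv f := by rfl

/-- `rowIn Y ≅ Yⁿ`. [folklore] -/
def rowInEquiv (Y : Submodule ℂ (Fin n → ℂ)) : rowIn Y ≃ₗ[ℂ] (Fin n → Y) where
  toFun A i := ⟨(A : Matrix (Fin n) (Fin n) ℂ) i, A.2 i⟩
  map_add' A B := by ext; rfl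
  map_smul' c A := by ext; rfl
  invFun f := ⟨Matrix.of fun i j => (f i : Fin n → ℂ) j, fun i => (f i).2⟩
  left_inv A := by rfl
  right_inv f := by rfl

/-- `dim colIn Y = n · dim Y`. [cite: MakamWigderson2021, Thm 1.13 (proof, elementary route: linear algebra step)] -/
theorem finrank_colIn (Y : Submodule ℂ (Fin n → ℂ)) : finrank ℂ (colIn Y) = n * finrank ℂ Y := by
  rw [(colInEquiv Y).finrank_eq, Module.finrank_pi_fintype, Finset.sum_const, Finset.card_univ,
    Fintype.card_fin, smul_eq_mul]

/-- `dim rowIn Y = n · dim Y`. [cite: MakamWigderson2021, Thm 1.13 (proof, elementary route: linear algebra step)] -/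
theorem finrank_rowIn (Y : Submodule ℂ (Fin n → ℂ)) : finrank ℂ (rowIn Y) = n * finrank ℂ Y := by
  rw [(rowInEquiv Y).finrank_eq, Module.finrank_pi_fintype, Finset.sum_const, Finset.card_univ,
    Fintype.card_fin, smul_eq_mul]

/-- The dot-orthogonal space `T^⊥ = {y | ∀ q ∈ T, q · y = 0}` of a set of vectors. [folklore] -/
def perp (T : Set (Fin n → ℂ)) : Submodule ℂ (Fin n → ℂ) where
  carrier := {y | ∀ q ∈ T, q ⬝ᵥ y = 0}
  add_mem' := fun hy hz q hq => by rw [dotProduct_add, hy q hq, hz q hq, add_zero]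
  zero_mem' := fun q _ => dotProduct_zero q
  smul_mem' := fun c _ hy q hq => by rw [dotProduct_smul, hy q hq, smul_zero]

/-- Membership in `perp`. [cite: MakamWigderson2021, Thm 1.13 (proof, elementary route: linear algebra step)] -/
theorem mem_perp {T : Set (Fin n → ℂ)} {y : Fin n → ℂ} : y ∈ perp T ↔ ∀ q ∈ T, q ⬝ᵥ y = 0 :=
  Iff.rfl

/-- `⋂_{q ∈ T} K^q = colIn T^⊥`. [cite: MakamWigderson2021, Thm 1.13 (proof, elementary route: linear algebra step)] -/
theorem iInf_cokerMat_eq_colIn (T : Set (Fin n → ℂ)) :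
    ⨅ q : T, cokerMat (q : Fin n → ℂ) = colIn (perp T) := by
  ext A
  simp only [Submodule.mem_iInf, mem_cokerMat, mem_colIn, mem_perp, Subtype.forall]
  constructor
  · intro h j q hq
    have := congrFun (h q hq) j
    simpa [vecMul, dotProduct] using this
  · intro h q hq
    funext j
    have := h j q hq
    simpa [vecMul, dotProduct] using this

/-- `⋂_{p ∈ T} K_p = rowIn T^⊥`. [cite: MakamWigderson2021, Thm 1.13 (proof, elementary route: linear algebra step)] -/
theorem iInf_kerMat_eq_rowIn (T : Set (Fin n → ℂ)) :
    ⨅ p : T, kerMat (p : Fin n → ℂ) = rowIn (perp T) := by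
  ext A
  simp only [Submodule.mem_iInf, mem_kerMat, mem_rowIn, mem_perp, Subtype.forall]
  constructor
  · intro h i p hp
    have := congrFun (h p hp) i
    rw [dotProduct_comm]
    simpa [mulVec] using this
  · intro h p hp
    funext i
    have := h i p hp
    rw [dotProduct_comm] at this
    simpa [mulVec] using this

/-- Separation by the dot product: if `y ∉ ℂa` (`a ≠ 0`) some `q ⊥ a` has `q · y ≠ 0`
(`q = a_k e_j - a_j e_k`). [cite: MakamWigderson2021, Thm 1.13 (proof, elementary route: linear algebra step)] -/
theorem exists_perp_not_perp {a y : Fin n → ℂ} (ha : a ≠ 0) (hy : y ∉ (ℂ ∙ a)) :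
    ∃ q : Fin n → ℂ, q ⬝ᵥ a = 0 ∧ q ⬝ᵥ y ≠ 0 := by
  classical
  obtain ⟨k, hk⟩ : ∃ k, a k ≠ 0 := Function.ne_iff.1 ha
  by_contra h
  simp only [not_exists, not_and, not_not] at h
  apply hy
  rw [Submodule.mem_span_singleton]
  refine ⟨y k / a k, ?_⟩
  funext j
  have hq := h (Pi.single j (a k) - Pi.single k (a j)) (by
    simp [sub_dotProduct, mul_comm])
  simp only [sub_dotProduct, single_dotProduct, sub_eq_zero] at hq
  -- `hq : a k * y j = a j * y k`
  simp only [Pi.smul_apply, smul_eq_mul]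
  rw [div_mul_eq_mul_div, div_eq_iff hk]
  linear_combination -hq

/-- Double orthogonal: `(a^⊥ ∖ 0)^⊥ = ℂa` for `a ≠ 0`. [cite: MakamWigderson2021, Thm 1.13 (proof, elementary route: linear algebra step)] -/
theorem perp_orth_eq_span {a : Fin n → ℂ} (ha : a ≠ 0) :
    perp {q : Fin n → ℂ | q ≠ 0 ∧ q ⬝ᵥ a = 0} = ℂ ∙ a := by
  ext y
  constructor
  · intro hy
    by_contra hya
    obtain ⟨q, hqa, hqy⟩ := exists_perp_not_perp ha hya
    have hq0 : q ≠ 0 := by rintro rfl; exact hqy (zero_dotProduct y)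
    exact hqy (hy q ⟨hq0, hqa⟩)
  · intro hy q hq
    obtain ⟨c, rfl⟩ := Submodule.mem_span_singleton.1 hy
    rw [dotProduct_smul, hq.2, smul_zero]

/-! ### Column type `C_a = ℂ^m ⊗ a ⊗ ℂⁿ`, row type `D_b = ℂ^m ⊗ ℂⁿ ⊗ b`, rank-one planes -/

/-- `C_a`: tuples all of whose components have all columns in `ℂa`. [folklore] -/
def colType (m : ℕ) (a : Fin n → ℂ) : Submodule ℂ (Tuple n m) := tupleOf (colIn (ℂ ∙ a))

/-- `D_b`: tuples all of whose components have all rows in `ℂb`. [folklore] -/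
def rowType (m : ℕ) (b : Fin n → ℂ) : Submodule ℂ (Tuple n m) := tupleOf (rowIn (ℂ ∙ b))

/-- `C_a = ⋂_{q ⊥ a, q ≠ 0} (ℂ^m ⊗ K^q)`. [cite: MakamWigderson2021, Thm 1.13 (proof, elementary route: linear algebra step)] -/
theorem colType_eq_iInf {a : Fin n → ℂ} (ha : a ≠ 0) :
    colType m a = ⨅ q : {q : Fin n → ℂ // q ≠ 0 ∧ q ⬝ᵥ a = 0},
      tupleOf (m := m) (cokerMat (q : Fin n → ℂ)) := by
  rw [colType, ← perp_orth_eq_span ha, ← iInf_cokerMat_eq_colIn, tupleOf_iInf]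
  rfl

/-- `D_b = ⋂_{p ⊥ b, p ≠ 0} (ℂ^m ⊗ K_p)`. [cite: MakamWigderson2021, Thm 1.13 (proof, elementary route: linear algebra step)] -/
theorem rowType_eq_iInf {b : Fin n → ℂ} (hb : b ≠ 0) :
    rowType m b = ⨅ p : {p : Fin n → ℂ // p ≠ 0 ∧ p ⬝ᵥ b = 0},
      tupleOf (m := m) (kerMat (p : Fin n → ℂ)) := by
  rw [rowType, ← perp_orth_eq_span hb, ← iInf_kerMat_eq_rowIn, tupleOf_iInf]
  rfl

/-- `dim C_a = m n`. [cite: MakamWigderson2021, Thm 1.13 (proof, elementary route: linear algebra step)] -/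
theorem finrank_colType {a : Fin n → ℂ} (ha : a ≠ 0) : finrank ℂ (colType m a) = m * n := by
  rw [colType, finrank_tupleOf, finrank_colIn, finrank_span_singleton ha, mul_one]

/-- `dim D_b = m n`. [cite: MakamWigderson2021, Thm 1.13 (proof, elementary route: linear algebra step)] -/
theorem finrank_rowType {b : Fin n → ℂ} (hb : b ≠ 0) : finrank ℂ (rowType m b) = m * n := by
  rw [rowType, finrank_tupleOf, finrank_rowIn, finrank_span_singleton hb, mul_one]

/-- Matrices with columns in `ℂa` and rows in `ℂb` are the multiples of `a bᵀ`. [cite: MakamWigderson2021, Thm 1.13 (proof, elementary route: linear algebra step)] -/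
theorem colIn_inf_rowIn {a b : Fin n → ℂ} (ha : a ≠ 0) :
    colIn (ℂ ∙ a) ⊓ rowIn (ℂ ∙ b) = ℂ ∙ vecMulVec a b := by
  classical
  ext A
  rw [Submodule.mem_inf, mem_colIn, mem_rowIn, Submodule.mem_span_singleton]
  constructor
  · rintro ⟨hcol, hrow⟩
    obtain ⟨k, hk⟩ : ∃ k, a k ≠ 0 := Function.ne_iff.1 ha
    obtain ⟨c, hc⟩ := Submodule.mem_span_singleton.1 (hrow k)
    refine ⟨c / a k, ?_⟩
    ext i j
    obtain ⟨d, hd⟩ := Submodule.mem_span_singleton.1 (hcol j)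
    have hij : A i j = d * a i := by simpa using (congrFun hd i).symm
    have hkj : A k j = d * a k := by simpa using (congrFun hd k).symm
    have hkj' : A k j = c * b j := by simpa using (congrFun hc j).symm
    have e1 : d * a k = c * b j := by rw [← hkj, ← hkj']
    have hd' : d = c * b j / a k := (eq_div_iff hk).2 e1
    rw [Matrix.smul_apply, vecMulVec_apply, smul_eq_mul, hij, hd']
    field_simp
  · rintro ⟨c, rfl⟩
    constructor
    · intro j
      refine Submodule.mem_span_singleton.2 ⟨c * b j, ?_⟩
      funext i; simp [vecMulVec_apply, mul_comm, mul_left_comm]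
    · intro i
      refine Submodule.mem_span_singleton.2 ⟨c * a i, ?_⟩
      funext j; simp [vecMulVec_apply, mul_assoc]

/-- `C_a ∩ D_b = ℂ^m ⊗ (a bᵀ)` (the rank-one plane). [cite: MakamWigderson2021, Thm 1.13 (proof, elementary route: linear algebra step)] -/
theorem colType_inf_rowType {a b : Fin n → ℂ} (ha : a ≠ 0) :
    colType m a ⊓ rowType m b = tupleOf (ℂ ∙ vecMulVec a b) := by
  rw [colType, rowType, ← tupleOf_inf, colIn_inf_rowIn ha]

/-! ### Images under a type-preserving automorphism -/

section Images

variable (e : Tuple n m ≃ₗ[ℂ] Tuple n m)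

/-- A submodule of dimension `1` is the span of a nonzero vector. [cite: MakamWigderson2021, Thm 1.13 (proof, elementary route: linear algebra step)] -/
theorem exists_eq_span_of_finrank_eq_one {V : Type*} [AddCommGroup V] [Module ℂ V]
    (Y : Submodule ℂ V) (h : finrank ℂ Y = 1) : ∃ v : V, v ≠ 0 ∧ Y = ℂ ∙ v := by
  obtain ⟨v, hv, hgen⟩ := finrank_eq_one_iff'.1 h
  refine ⟨(v : V), fun h0 => hv (Subtype.ext h0), ?_⟩
  ext y
  constructor
  · intro hy
    obtain ⟨c, hc⟩ := hgen ⟨y, hy⟩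
    exact Submodule.mem_span_singleton.2 ⟨c, by simpa using congrArg Subtype.val hc⟩
  · intro hy
    obtain ⟨c, rfl⟩ := Submodule.mem_span_singleton.1 hy
    exact Y.smul_mem c v.2

/-- **Column types go to column types** under a coker-type-preserving automorphism:
`e(C_a) = C_{a'}` (intersect the images `ℂ^m ⊗ K^{ψ(q)}`, `q ⊥ a`, and count dimensions).
[cite: MakamWigderson2021, Thm 1.13 (elementary route, step D)] -/
theorem exists_map_colType_eq (hm : 1 ≤ m) (hn : 1 ≤ n)
    (hcoker : ∀ w : Fin n → ℂ, w ≠ 0 → ∃ w' : Fin n → ℂ, w' ≠ 0 ∧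
      (tupleOf (m := m) (cokerMat w)).map (e : Tuple n m →ₗ[ℂ] Tuple n m) = tupleOf (cokerMat w'))
    {a : Fin n → ℂ} (ha : a ≠ 0) :
    ∃ a' : Fin n → ℂ, a' ≠ 0 ∧ (colType m a).map (e : Tuple n m →ₗ[ℂ] Tuple n m) = colType m a' := by
  classical
  choose ψ hψ0 hψ using hcoker
  let T' : Set (Fin n → ℂ) :=
    Set.range fun q : {q : Fin n → ℂ // q ≠ 0 ∧ q ⬝ᵥ a = 0} => ψ q.1 q.2.1
  have himage : (colType m a).map (e : Tuple n m →ₗ[ℂ] Tuple n m) = tupleOf (colIn (perp T')) := by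
    rw [colType_eq_iInf ha, Submodule.map_equiv_eq_comap_symm, Submodule.comap_iInf]
    have : ∀ q : {q : Fin n → ℂ // q ≠ 0 ∧ q ⬝ᵥ a = 0},
        (tupleOf (m := m) (cokerMat (q : Fin n → ℂ))).comap
          ((e.symm : Tuple n m ≃ₗ[ℂ] Tuple n m) : Tuple n m →ₗ[ℂ] Tuple n m) =
        tupleOf (cokerMat (ψ q.1 q.2.1)) := fun q => by
      rw [← Submodule.map_equiv_eq_comap_symm]; exact hψ q.1 q.2.1
    simp_rw [this]
    rw [← iInf_cokerMat_eq_colIn, tupleOf_iInf]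
    -- reindex the infimum over the range `T'`
    apply le_antisymm
    · refine le_iInf fun t => ?_
      obtain ⟨q, hq⟩ := t.2
      rw [← hq]
      exact iInf_le _ q
    · refine le_iInf fun q => ?_
      exact iInf_le (fun t : T' => tupleOf (m := m) (cokerMat (t : Fin n → ℂ)))
        ⟨ψ q.1 q.2.1, q, rfl⟩
  have hdim : finrank ℂ (perp T') = 1 := by
    have h1 := finrank_colType (m := m) ha
    rw [← LinearEquiv.finrank_map_eq e (colType m a)] at h1
    change finrank ℂ ((colType m a).map (e : Tuple n m →ₗ[ℂ] Tuple n m)) = m * n at h1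
    rw [himage, finrank_tupleOf, finrank_colIn, ← mul_assoc] at h1
    have hmn : 0 < m * n := Nat.mul_pos hm hn
    nlinarith [h1, hmn]
  obtain ⟨a', ha', hY⟩ := exists_eq_span_of_finrank_eq_one _ hdim
  exact ⟨a', ha', by rw [himage, hY]; rfl⟩

/-- **Row types go to row types** under a kernel-type-preserving automorphism:
`e(D_b) = D_{b'}`. [cite: MakamWigderson2021, Thm 1.13 (elementary route, step D)] -/
theorem exists_map_rowType_eq (hm : 1 ≤ m) (hn : 1 ≤ n)
    (hker : ∀ v : Fin n → ℂ, v ≠ 0 → ∃ v' : Fin n → ℂ, v' ≠ 0 ∧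
      (tupleOf (m := m) (kerMat v)).map (e : Tuple n m →ₗ[ℂ] Tuple n m) = tupleOf (kerMat v'))
    {b : Fin n → ℂ} (hb : b ≠ 0) :
    ∃ b' : Fin n → ℂ, b' ≠ 0 ∧ (rowType m b).map (e : Tuple n m →ₗ[ℂ] Tuple n m) = rowType m b' := by
  classical
  choose φ hφ0 hφ using hker
  let T' : Set (Fin n → ℂ) :=
    Set.range fun p : {p : Fin n → ℂ // p ≠ 0 ∧ p ⬝ᵥ b = 0} => φ p.1 p.2.1
  have himage : (rowType m b).map (e : Tuple n m →ₗ[ℂ] Tuple n m) = tupleOf (rowIn (perp T')) := by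
    rw [rowType_eq_iInf hb, Submodule.map_equiv_eq_comap_symm, Submodule.comap_iInf]
    have : ∀ p : {p : Fin n → ℂ // p ≠ 0 ∧ p ⬝ᵥ b = 0},
        (tupleOf (m := m) (kerMat (p : Fin n → ℂ))).comap
          ((e.symm : Tuple n m ≃ₗ[ℂ] Tuple n m) : Tuple n m →ₗ[ℂ] Tuple n m) =
        tupleOf (kerMat (φ p.1 p.2.1)) := fun p => by
      rw [← Submodule.map_equiv_eq_comap_symm]; exact hφ p.1 p.2.1
    simp_rw [this]
    rw [← iInf_kerMat_eq_rowIn, tupleOf_iInf]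
    apply le_antisymm
    · refine le_iInf fun t => ?_
      obtain ⟨p, hp⟩ := t.2
      rw [← hp]
      exact iInf_le _ p
    · refine le_iInf fun p => ?_
      exact iInf_le (fun t : T' => tupleOf (m := m) (kerMat (t : Fin n → ℂ)))
        ⟨φ p.1 p.2.1, p, rfl⟩
  have hdim : finrank ℂ (perp T') = 1 := by
    have h1 := finrank_rowType (m := m) hb
    rw [← LinearEquiv.finrank_map_eq e (rowType m b)] at h1
    change finrank ℂ ((rowType m b).map (e : Tuple n m →ₗ[ℂ] Tuple n m)) = m * n at h1
    rw [himage, finrank_tupleOf, finrank_rowIn, ← mul_assoc] at h1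
    have hmn : 0 < m * n := Nat.mul_pos hm hn
    nlinarith [h1, hmn]
  obtain ⟨b', hb', hY⟩ := exists_eq_span_of_finrank_eq_one _ hdim
  exact ⟨b', hb', by rw [himage, hY]; rfl⟩

/-- **Rank-one planes go to rank-one planes**: if `e(C_a) = C_{a'}` and `e(D_b) = D_{b'}` then
`e(ℂ^m ⊗ a bᵀ) = ℂ^m ⊗ a' b'ᵀ`. [cite: MakamWigderson2021, Thm 1.13 (elementary route, step D)] -/
theorem map_rankOnePlane {a b a' b' : Fin n → ℂ} (ha : a ≠ 0) (ha' : a' ≠ 0)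
    (hCa : (colType m a).map (e : Tuple n m →ₗ[ℂ] Tuple n m) = colType m a')
    (hDb : (rowType m b).map (e : Tuple n m →ₗ[ℂ] Tuple n m) = rowType m b') :
    (tupleOf (m := m) (ℂ ∙ vecMulVec a b)).map (e : Tuple n m →ₗ[ℂ] Tuple n m) =
      tupleOf (ℂ ∙ vecMulVec a' b') := by
  rw [← colType_inf_rowType ha, Submodule.map_inf _ e.injective, hCa, hDb,
    colType_inf_rowType ha']

end Images

/-! ### The two families `ℂ^m ⊗ K_v`, `ℂ^m ⊗ K^w`: sums, distinctness, transposition -/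

/-- `K_{cv} = K_v`. [cite: MakamWigderson2021, Thm 1.13 (proof, elementary route: linear algebra step)] -/
theorem kerMat_eq_of_mem_span {v v' : Fin n → ℂ} (hv : v ≠ 0) (h : v ∈ (ℂ ∙ v')) :
    kerMat v = kerMat v' := by
  obtain ⟨c, rfl⟩ := Submodule.mem_span_singleton.1 h
  have hc : c ≠ 0 := by rintro rfl; exact hv (zero_smul _ _)
  ext A
  simp only [mem_kerMat, mulVec_smul, smul_eq_zero, hc, false_or]

/-- `K^{cw} = K^w`. [cite: MakamWigderson2021, Thm 1.13 (proof, elementary route: linear algebra step)] -/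
theorem cokerMat_eq_of_mem_span {w w' : Fin n → ℂ} (hw : w ≠ 0) (h : w ∈ (ℂ ∙ w')) :
    cokerMat w = cokerMat w' := by
  obtain ⟨c, rfl⟩ := Submodule.mem_span_singleton.1 h
  have hc : c ≠ 0 := by rintro rfl; exact hw (zero_smul _ _)
  ext A
  simp only [mem_cokerMat, smul_vecMul, smul_eq_zero, hc, false_or]

/-- **Two distinct kernel-type spaces span everything**: `ℂ^m ⊗ K_v + ℂ^m ⊗ K_{v'} = Mat_n^m` if
`v ∉ ℂv'`. [cite: MakamWigderson2021, Thm 1.13 (proof, elementary route: linear algebra step)] -/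
theorem sup_tupleOf_kerMat_eq_top {v v' : Fin n → ℂ} (hv' : v' ≠ 0) (h : v ∉ (ℂ ∙ v')) :
    tupleOf (m := m) (kerMat v) ⊔ tupleOf (kerMat v') = ⊤ := by
  obtain ⟨q, hqv', hqv⟩ := exists_perp_not_perp hv' h
  set ℓ : Fin n → ℂ := (q ⬝ᵥ v)⁻¹ • q with hℓ
  have hℓv : ℓ ⬝ᵥ v = 1 := by rw [hℓ, smul_dotProduct, smul_eq_mul, inv_mul_cancel₀ hqv]
  have hℓv' : ℓ ⬝ᵥ v' = 0 := by rw [hℓ, smul_dotProduct, hqv', smul_zero]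
  rw [eq_top_iff]
  intro X _
  set X₂ : Tuple n m := fun i => vecMulVec (X i *ᵥ v) ℓ with hX₂
  rw [show X = (X - X₂) + X₂ by abel]
  refine Submodule.add_mem_sup (fun i => ?_) (fun i => ?_)
  · rw [mem_kerMat, Pi.sub_apply, sub_mulVec, hX₂, vecMulVec_mulVec, hℓv]
    simp
  · rw [mem_kerMat, hX₂, vecMulVec_mulVec, hℓv']
    simp

/-- **Two distinct cokernel-type spaces span everything.** [cite: MakamWigderson2021, Thm 1.13 (proof, elementary route: linear algebra step)] -/
theorem sup_tupleOf_cokerMat_eq_top {w w' : Fin n → ℂ} (hw' : w' ≠ 0) (h : w ∉ (ℂ ∙ w')) :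
    tupleOf (m := m) (cokerMat w) ⊔ tupleOf (cokerMat w') = ⊤ := by
  obtain ⟨q, hqw', hqw⟩ := exists_perp_not_perp hw' h
  set ℓ : Fin n → ℂ := (q ⬝ᵥ w)⁻¹ • q with hℓ
  have hℓw : w ⬝ᵥ ℓ = 1 := by
    rw [dotProduct_comm, hℓ, smul_dotProduct, smul_eq_mul, inv_mul_cancel₀ hqw]
  have hℓw' : w' ⬝ᵥ ℓ = 0 := by rw [dotProduct_comm, hℓ, smul_dotProduct, hqw', smul_zero]
  rw [eq_top_iff]
  intro X _
  set X₂ : Tuple n m := fun i => vecMulVec ℓ (w ᵥ* X i) with hX₂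
  rw [show X = (X - X₂) + X₂ by abel]
  refine Submodule.add_mem_sup (fun i => ?_) (fun i => ?_)
  · rw [mem_cokerMat, Pi.sub_apply, vecMul_sub, hX₂, vecMul_vecMulVec, hℓw, one_smul, sub_self]
  · rw [mem_cokerMat, hX₂, vecMul_vecMulVec, hℓw', zero_smul]

/-- **A kernel-type and a cokernel-type space never span everything**: every member `X` of
`ℂ^m ⊗ K_v + ℂ^m ⊗ K^w` has `wᵀ X_i v = 0`. [cite: MakamWigderson2021, Thm 1.13 (proof, elementary route: linear algebra step)] -/
theorem sup_tupleOf_kerMat_cokerMat_ne_top (hm : 1 ≤ m) {v w : Fin n → ℂ} (hv : v ≠ 0)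
    (hw : w ≠ 0) : tupleOf (m := m) (kerMat v) ⊔ tupleOf (cokerMat w) ≠ ⊤ := by
  classical
  intro htop
  have key : ∀ X ∈ tupleOf (m := m) (kerMat v) ⊔ tupleOf (cokerMat w), ∀ i, w ⬝ᵥ (X i *ᵥ v) = 0 := by
    intro X hX i
    obtain ⟨Y, hY, Z, hZ, rfl⟩ := Submodule.mem_sup.1 hX
    rw [Pi.add_apply, add_mulVec, dotProduct_add, (mem_kerMat).1 (hY i), dotProduct_zero, zero_add,
      dotProduct_mulVec, (mem_cokerMat).1 (hZ i), zero_dotProduct]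
  obtain ⟨k, hk⟩ : ∃ k, w k ≠ 0 := Function.ne_iff.1 hw
  obtain ⟨l, hl⟩ : ∃ l, v l ≠ 0 := Function.ne_iff.1 hv
  let X₀ : Tuple n m := fun _ => vecMulVec (Pi.single k 1) (Pi.single l 1)
  have := key X₀ (by rw [htop]; trivial) ⟨0, hm⟩
  simp only [X₀, vecMulVec_mulVec, single_dotProduct, one_mul] at this
  rw [dotProduct_smul] at this
  simp [hk, hl] at this

/-- For `n ≥ 2` the two families are disjoint: `K_v ≠ K^w`. [cite: MakamWigderson2021, Thm 1.13 (proof, elementary route: linear algebra step)] -/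
theorem kerMat_ne_cokerMat (hn : 2 ≤ n) {v w : Fin n → ℂ} (hv : v ≠ 0) (hw : w ≠ 0) :
    kerMat v ≠ cokerMat w := by
  classical
  intro heq
  obtain ⟨k, hk⟩ : ∃ k, w k ≠ 0 := Function.ne_iff.1 hw
  obtain ⟨l, hl⟩ : ∃ l, v l ≠ 0 := Function.ne_iff.1 hv
  obtain ⟨l', hl'⟩ : ∃ l' : Fin n, l' ≠ l := by
    by_contra h
    simp only [not_exists, not_not] at h
    have : Fintype.card (Fin n) ≤ 1 := Fintype.card_le_one_iff.2 fun a b => (h a).trans (h b).symm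
    rw [Fintype.card_fin] at this
    omega
  -- `z = v_l e_{l'} - v_{l'} e_l` is orthogonal to `v` and nonzero
  set z : Fin n → ℂ := v l • Pi.single l' 1 - v l' • Pi.single l 1 with hz
  have hzv : z ⬝ᵥ v = 0 := by
    simp [hz, sub_dotProduct, smul_dotProduct, single_dotProduct, mul_comm]
  set A : Matrix (Fin n) (Fin n) ℂ := vecMulVec (Pi.single k 1) z with hA
  have hAker : A ∈ kerMat v := by rw [mem_kerMat, hA, vecMulVec_mulVec, hzv]; simp
  rw [heq, mem_cokerMat, hA, vecMul_vecMulVec, dotProduct_single, mul_one] at hAker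
  have := congrFun hAker l'
  simp [hz, hk, hl, hl'] at this

/-- Hence `ℂ^m ⊗ K_v ≠ ℂ^m ⊗ K^w` (`n ≥ 2`, `m ≥ 1`). [cite: MakamWigderson2021, Thm 1.13 (proof, elementary route: linear algebra step)] -/
theorem tupleOf_kerMat_ne_tupleOf_cokerMat (hn : 2 ≤ n) (hm : 1 ≤ m) {v w : Fin n → ℂ}
    (hv : v ≠ 0) (hw : w ≠ 0) : tupleOf (m := m) (kerMat v) ≠ tupleOf (cokerMat w) := fun h =>
  kerMat_ne_cokerMat hn hv hw (le_antisymm (le_of_tupleOf_le hm h.le) (le_of_tupleOf_le hm h.ge))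

/-- `τ(ℂ^m ⊗ K_v) = ℂ^m ⊗ K^v`. [cite: MakamWigderson2021, Thm 1.13 (the rôle of τ)] -/
theorem map_transposeMap_tupleOf_kerMat (v : Fin n → ℂ) :
    (tupleOf (m := m) (kerMat v)).map (transposeMap n m) = tupleOf (cokerMat v) := by
  ext Y
  constructor
  · rintro ⟨X, hX, rfl⟩ i
    rw [mem_cokerMat]
    show v ᵥ* (X i)ᵀ = 0
    rw [vecMul_transpose]; exact hX i
  · intro hY
    refine ⟨transposeMap n m Y, fun i => ?_, ?_⟩
    · rw [mem_kerMat]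
      show (Y i)ᵀ *ᵥ v = 0
      rw [mulVec_transpose]; exact hY i
    · exact congrArg (fun f => f Y) (transposeMap_mul_self n m)

/-- `τ(ℂ^m ⊗ K^w) = ℂ^m ⊗ K_w`. [cite: MakamWigderson2021, Thm 1.13 (the rôle of τ)] -/
theorem map_transposeMap_tupleOf_cokerMat (w : Fin n → ℂ) :
    (tupleOf (m := m) (cokerMat w)).map (transposeMap n m) = tupleOf (kerMat w) := by
  ext Y
  constructor
  · rintro ⟨X, hX, rfl⟩ i
    rw [mem_kerMat]
    show (X i)ᵀ *ᵥ w = 0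
    rw [mulVec_transpose]; exact hX i
  · intro hY
    refine ⟨transposeMap n m Y, fun i => ?_, ?_⟩
    · rw [mem_cokerMat]
      show w ᵥ* (Y i)ᵀ = 0
      rw [vecMul_transpose]; exact hY i
    · exact congrArg (fun f => f Y) (transposeMap_mul_self n m)

/-! ### The kind of a symmetry: type-preserving or type-swapping -/

/-- `e` maps every `ℂ^m ⊗ K_v` to some `ℂ^m ⊗ K_{v'}` and every `ℂ^m ⊗ K^w` to some `ℂ^m ⊗ K^{w'}`.
[cite: MakamWigderson2021, Thm 1.13 (elementary route, step C)] -/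
def TypePreserving (e : Tuple n m ≃ₗ[ℂ] Tuple n m) : Prop :=
  (∀ v : Fin n → ℂ, v ≠ 0 → ∃ v' : Fin n → ℂ, v' ≠ 0 ∧
      (tupleOf (m := m) (kerMat v)).map (e : Tuple n m →ₗ[ℂ] Tuple n m) = tupleOf (kerMat v')) ∧
    ∀ w : Fin n → ℂ, w ≠ 0 → ∃ w' : Fin n → ℂ, w' ≠ 0 ∧
      (tupleOf (m := m) (cokerMat w)).map (e : Tuple n m →ₗ[ℂ] Tuple n m) = tupleOf (cokerMat w')

/-- `e` maps every `ℂ^m ⊗ K_v` to some `ℂ^m ⊗ K^{w'}` and every `ℂ^m ⊗ K^w` to some `ℂ^m ⊗ K_{v'}`.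
[cite: MakamWigderson2021, Thm 1.13 (elementary route, step C)] -/
def TypeSwapping (e : Tuple n m ≃ₗ[ℂ] Tuple n m) : Prop :=
  (∀ v : Fin n → ℂ, v ≠ 0 → ∃ w' : Fin n → ℂ, w' ≠ 0 ∧
      (tupleOf (m := m) (kerMat v)).map (e : Tuple n m →ₗ[ℂ] Tuple n m) = tupleOf (cokerMat w')) ∧
    ∀ w : Fin n → ℂ, w ≠ 0 → ∃ v' : Fin n → ℂ, v' ≠ 0 ∧
      (tupleOf (m := m) (cokerMat w)).map (e : Tuple n m →ₗ[ℂ] Tuple n m) = tupleOf (kerMat v')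

/-- **Step C.** A linear automorphism of `Mat_n^m` (`n ≥ 2`, `m ≥ 1`) mapping a set `S` into
itself, where `S` contains every `ℂ^m ⊗ K_v`, `ℂ^m ⊗ K^w` and where these are the only linear
subspaces of `S` of dimension `m·n(n-1)`, is type-preserving or type-swapping.
[cite: MakamWigderson2021, Thm 1.13 (elementary route, step C)] -/
theorem typePreserving_or_typeSwapping (hn : 2 ≤ n) (hm : 1 ≤ m) (S : Set (Tuple n m))
    (hSmax : ∀ U : Submodule ℂ (Tuple n m), (U : Set (Tuple n m)) ⊆ S →
      finrank ℂ U = m * (n * (n - 1)) →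
        (∃ v : Fin n → ℂ, v ≠ 0 ∧ U = tupleOf (kerMat v)) ∨
          (∃ w : Fin n → ℂ, w ≠ 0 ∧ U = tupleOf (cokerMat w)))
    (hSker : ∀ v : Fin n → ℂ, v ≠ 0 → (tupleOf (m := m) (kerMat v) : Set (Tuple n m)) ⊆ S)
    (hScoker : ∀ w : Fin n → ℂ, w ≠ 0 → (tupleOf (m := m) (cokerMat w) : Set (Tuple n m)) ⊆ S)
    (e : Tuple n m ≃ₗ[ℂ] Tuple n m) (he : Set.MapsTo e S S) :
    TypePreserving e ∨ TypeSwapping e := by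
  classical
  have hn1 : 1 ≤ n := by omega
  -- images of the two families are members of the two families
  have img : ∀ v : Fin n → ℂ, v ≠ 0 →
      (∃ v', v' ≠ 0 ∧ (tupleOf (m := m) (kerMat v)).map (e : Tuple n m →ₗ[ℂ] Tuple n m) =
        tupleOf (kerMat v')) ∨
      (∃ w', w' ≠ 0 ∧ (tupleOf (m := m) (kerMat v)).map (e : Tuple n m →ₗ[ℂ] Tuple n m) =
        tupleOf (cokerMat w')) := by
    intro v hv
    refine hSmax _ ?_ ?_
    · rintro _ ⟨X, hX, rfl⟩; exact he (hSker v hv hX)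
    · rw [LinearEquiv.finrank_map_eq, finrank_tupleOf, finrank_kerMat hv]
  have imgc : ∀ w : Fin n → ℂ, w ≠ 0 →
      (∃ v', v' ≠ 0 ∧ (tupleOf (m := m) (cokerMat w)).map (e : Tuple n m →ₗ[ℂ] Tuple n m) =
        tupleOf (kerMat v')) ∨
      (∃ w', w' ≠ 0 ∧ (tupleOf (m := m) (cokerMat w)).map (e : Tuple n m →ₗ[ℂ] Tuple n m) =
        tupleOf (cokerMat w')) := by
    intro w hw
    refine hSmax _ ?_ ?_
    · rintro _ ⟨X, hX, rfl⟩; exact he (hScoker w hw hX)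
    · rw [LinearEquiv.finrank_map_eq, finrank_tupleOf, finrank_cokerMat hw]
  have hinj : Function.Injective (Submodule.map (e : Tuple n m →ₗ[ℂ] Tuple n m)) :=
    Submodule.map_injective_of_injective e.injective
  -- images of two different members never consist of one of each type
  have mixed : ∀ P Q : Submodule ℂ (Tuple n m), P ⊔ Q = ⊤ →
      ∀ v' w', v' ≠ 0 → w' ≠ 0 →
        P.map (e : Tuple n m →ₗ[ℂ] Tuple n m) = tupleOf (kerMat v') →
        Q.map (e : Tuple n m →ₗ[ℂ] Tuple n m) = tupleOf (cokerMat w') → False := by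
    intro P Q hPQ v' w' hv' hw' hP hQ
    have := congrArg (Submodule.map (e : Tuple n m →ₗ[ℂ] Tuple n m)) hPQ
    rw [Submodule.map_sup, hP, hQ, Submodule.map_top, LinearMap.range_eq_top.2 e.surjective] at this
    exact sup_tupleOf_kerMat_cokerMat_ne_top hm hv' hw' this
  -- (F1) two kernel-type members have images of the same type
  have F1 : ∀ v₁ v₂ : Fin n → ℂ, v₁ ≠ 0 → v₂ ≠ 0 → ∀ v' w', v' ≠ 0 → w' ≠ 0 →
      (tupleOf (m := m) (kerMat v₁)).map (e : Tuple n m →ₗ[ℂ] Tuple n m) = tupleOf (kerMat v') →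
      (tupleOf (m := m) (kerMat v₂)).map (e : Tuple n m →ₗ[ℂ] Tuple n m) = tupleOf (cokerMat w') →
        False := by
    intro v₁ v₂ hv₁ hv₂ v' w' hv' hw' h₁ h₂
    by_cases h12 : v₁ ∈ (ℂ ∙ v₂)
    · rw [kerMat_eq_of_mem_span hv₁ h12] at h₁
      rw [h₁] at h₂
      exact tupleOf_kerMat_ne_tupleOf_cokerMat hn hm hv' hw' h₂
    · exact mixed _ _ (sup_tupleOf_kerMat_eq_top hv₂ h12) v' w' hv' hw' h₁ h₂
  -- (F2) two cokernel-type members have images of the same type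
  have F2 : ∀ w₁ w₂ : Fin n → ℂ, w₁ ≠ 0 → w₂ ≠ 0 → ∀ v' w', v' ≠ 0 → w' ≠ 0 →
      (tupleOf (m := m) (cokerMat w₁)).map (e : Tuple n m →ₗ[ℂ] Tuple n m) = tupleOf (kerMat v') →
      (tupleOf (m := m) (cokerMat w₂)).map (e : Tuple n m →ₗ[ℂ] Tuple n m) = tupleOf (cokerMat w') →
        False := by
    intro w₁ w₂ hw₁ hw₂ v' w' hv' hw' h₁ h₂
    by_cases h12 : w₁ ∈ (ℂ ∙ w₂)
    · rw [cokerMat_eq_of_mem_span hw₁ h12] at h₁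
      rw [h₁] at h₂
      exact tupleOf_kerMat_ne_tupleOf_cokerMat hn hm hv' hw' h₂
    · exact mixed _ _ (sup_tupleOf_cokerMat_eq_top hw₂ h12) v' w' hv' hw' h₁ h₂
  -- (F3) a kernel-type and a cokernel-type member have images of different types
  have F3 : ∀ v w : Fin n → ℂ, v ≠ 0 → w ≠ 0 → ∀ v₁ v₂, v₁ ≠ 0 → v₂ ≠ 0 →
      (tupleOf (m := m) (kerMat v)).map (e : Tuple n m →ₗ[ℂ] Tuple n m) = tupleOf (kerMat v₁) →
      (tupleOf (m := m) (cokerMat w)).map (e : Tuple n m →ₗ[ℂ] Tuple n m) = tupleOf (kerMat v₂) →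
        False := by
    intro v w hv hw v₁ v₂ hv₁ hv₂ h₁ h₂
    by_cases h12 : v₁ ∈ (ℂ ∙ v₂)
    · rw [kerMat_eq_of_mem_span hv₁ h12, ← h₂] at h₁
      exact tupleOf_kerMat_ne_tupleOf_cokerMat hn hm hv hw (hinj h₁)
    · have hne := sup_tupleOf_kerMat_cokerMat_ne_top hm hv hw (m := m)
      apply hne
      apply hinj
      rw [Submodule.map_sup, h₁, h₂, sup_tupleOf_kerMat_eq_top hv₂ h12, Submodule.map_top,
        LinearMap.range_eq_top.2 e.surjective]
  have F4 : ∀ v w : Fin n → ℂ, v ≠ 0 → w ≠ 0 → ∀ w₁ w₂, w₁ ≠ 0 → w₂ ≠ 0 →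
      (tupleOf (m := m) (kerMat v)).map (e : Tuple n m →ₗ[ℂ] Tuple n m) = tupleOf (cokerMat w₁) →
      (tupleOf (m := m) (cokerMat w)).map (e : Tuple n m →ₗ[ℂ] Tuple n m) = tupleOf (cokerMat w₂) →
        False := by
    intro v w hv hw w₁ w₂ hw₁ hw₂ h₁ h₂
    by_cases h12 : w₁ ∈ (ℂ ∙ w₂)
    · rw [cokerMat_eq_of_mem_span hw₁ h12, ← h₂] at h₁
      exact tupleOf_kerMat_ne_tupleOf_cokerMat hn hm hv hw (hinj h₁)
    · have hne := sup_tupleOf_kerMat_cokerMat_ne_top hm hv hw (m := m)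
      apply hne
      apply hinj
      rw [Submodule.map_sup, h₁, h₂, sup_tupleOf_cokerMat_eq_top hw₂ h12, Submodule.map_top,
        LinearMap.range_eq_top.2 e.surjective]
  -- decide by the image of one kernel-type member
  set v₀ : Fin n → ℂ := Pi.single ⟨0, hn1⟩ 1 with hv₀
  have hv₀0 : v₀ ≠ 0 := by
    intro h; have := congrFun h ⟨0, hn1⟩; simp [hv₀] at this
  rcases img v₀ hv₀0 with ⟨v₀', hv₀', h₀⟩ | ⟨w₀', hw₀', h₀⟩
  · left
    refine ⟨fun v hv => ?_, fun w hw => ?_⟩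
    · rcases img v hv with h | ⟨w', hw', h⟩
      · exact h
      · exact (F1 v₀ v hv₀0 hv v₀' w' hv₀' hw' h₀ h).elim
    · rcases imgc w hw with ⟨v', hv', h⟩ | h
      · exact (F3 v₀ w hv₀0 hw v₀' v' hv₀' hv' h₀ h).elim
      · exact h
  · right
    refine ⟨fun v hv => ?_, fun w hw => ?_⟩
    · rcases img v hv with ⟨v', hv', h⟩ | h
      · exact (F1 v v₀ hv hv₀0 v' w₀' hv' hw₀' h h₀).elim
      · exact h
    · rcases imgc w hw with h | ⟨w', hw', h⟩
      · exact h
      · exact (F4 v₀ w hv₀0 hw w₀' w' hw₀' hw' h₀ h).elim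

end MakamWigderson

end Literature.Computability.AlgebraicComplexity

end
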